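import Summits.BirchSwinnertonDyer.BirchSwinnertonDyer.Theorems.SylvesterTwoHeegnerIndexCMDataDerivative
import Literature.NumberTheory.EllipticCurves.RingClassFieldInertiaGenerator
import Literature.NumberTheory.EllipticCurves.HuShuYin2019.SylvesterNineMinimalModel
import Literature.NumberTheory.EllipticCurves.JZeroKolyvaginPrimes
import HarnessLib

/-!
# (F) of leaf (L1), crux `UpperOffV0HSYPlus` (stmt-BirchSwinnertonDyer-19804): PREPARATIONS for the AT-LEVEL
# FLIP at the level `9pℓ` — the inertia package at HSY's level and the root identity
# `(σ_ℓ − 1) D_ℓ y_ℓ = (ℓ + 1) y_ℓ`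

Skeleton of record VARIANT M (`Cruxes/UpperOffV0HSYPlus/Lines/coupled_variantM.lean` 406ca288e244d392);
card v28; planner D475 (GO on the rows' (F) assembly).  The sibling `…CMFlipLevelPrime` instantiates k-ty1
#14 (`JZero.zsmul_kolyvaginClass_cubicTwist_mem_selmerLocalKer_iff_mem_torsionLocalKer`, p650073) for the HSY
pair at the single-prime level; this file supplies, as separate theorems (audit trail: each discharged #14
binder with its source):

* `smul_embPoints_sub_eq_zsmul` — a finite-level identity `σ P − P = n • Q` read in `W(K̄)` along an
  embedding (abstract level field, one `DecidableEq`; bridge for `hR`);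
* `inertia_package` — k-ty1 #17b §3–§4 (p658810) at the level written `9 * p * ℓ`: the inertia generator
  `τ₀ ↦ σ_ℓ` acting on `N`-fixed points through `⟨τ₀⟩` (#14's `hτ₀`/`hIτ₀`) and `I_𝔓, Frob_𝔓 ⊆ N'`
  (behind `hIv₁`, `hFv₂`, `hFP₂`);
* `pointGalHom_derivOp_sub_eq_of_trace_eq_zero` — Gross's (3.5) on points: `σ(D_σ z) − D_σ z = (ℓ + 1) z`
  whenever `σ^{ℓ+1} = 1` and `Tr_σ z = 0` (any curve, any level field; also the pair level's root);
* `pointGalHom_derivOp_sub_eq` — **`σ_ℓ(D_ℓ y_ℓ) − D_ℓ y_ℓ = (ℓ + 1) y_ℓ`** on the minimal model `W₀` of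
  `E₉` ((3.5) + (ES1) #R-b `sum_range_pointGalHom_pow_eq_lFunction_smul_sylvester_prime` + `a_ℓ(E₉) = 0`):
  the ROOT of #14 is `R = l' • κ⁻¹ ι(y_ℓ)`;
(The bottom point `P₁ = κ⁻¹ ι(y₁)` and its class at `λ` are the sibling `…CMFlipBottomClass`.)

HONEST FRAMING: theorems only (no definition, no named fact, no instance, no notation); assembly of PROVED
tree theorems; nothing about Sel/Ш/the FLIP iff/BSD here; no stub closed;
`--supports stmt-BirchSwinnertonDyer-19804 --as helper`.

## References
* B. H. Gross, LMS LNS 153 (1991), §3 (3.3)–(3.5), Prop. 3.6, 3.7, Prop. 6.2, §4 (4.1)–(4.6). [GrossLMS1991]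
* W. G. McCallum, LMS LNS 153 (1991), §4 (p. 304), Prop. 4.4. [McCallumLMS1991]
* Y. Hu, J. Shu, H. Yin, Trans. AMS 372 (2019), arXiv 1708.05266, §2 Prop. 2.4, §4.1. [HuShuYin2019]
* D. A. Cox, *Primes of the form x² + ny²*, 2nd ed., §9.A. [Cox2013]

## Mathlib / tree search
Tree: `exists_mem_inertia_generator_and_forall_smul_eq_pow_smul`, `mem_of_mem_inertia_and_mem_of_isArithFrobAt`
(#17b), `KolyvaginEuler.of_sub_one_mul_derivElt` / `grAct_*` (Gross (3.5)),
`SylvesterTwoCMData.sum_range_pointGalHom_pow_eq_lFunction_smul_sylvester_prime`, `orderOf_eq_succ_sylvester_prime`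
(#R-b), `JZero.lFunction_eq_zero_of_j_eq_zero_of_mod_three_eq_two`, `exists_map_eq_phi_sylvesterTau_one_of_sq_add_self_add_one`,
`smul_embPoints_eq_of_comp`, `map_toRatAlgHom_eq_pointGalHom` (`GeomPointsEmbeddingDescent`).
`lean search 'inertia_package|derivOp_sub_eq'` → nothing before this file.  presearch: n/a (assembly).
-/

set_option linter.dupNamespace false -- Summits modules are `Summit.<Summit>.<Problem>…` by design
set_option autoImplicit false

noncomputable section

open scoped Classical Pointwise

namespace Summit.BirchSwinnertonDyer.BirchSwinnertonDyer.Theorems.SylvesterTwoCMFlip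

open WeierstrassCurve Field NumberField IsDedekindDomain Finset
open Literature.NumberTheory.EllipticCurves Literature.NumberTheory.GaloisRepresentations
  Literature.NumberTheory.EllipticCurves.ModularForms
  Literature.NumberTheory.EllipticCurves.HuShuYin2019
  Literature.NumberTheory.EllipticCurves.KolyvaginCocycle
  Summit.BirchSwinnertonDyer.BirchSwinnertonDyer.Theorems.SylvesterTwoCMData
  Summit.BirchSwinnertonDyer.Rank1Residual.X11b
  Summit.BirchSwinnertonDyer.Rank1Residual.X11b.RingClassTower

variable {K : Type} [Field K] [NumberField K]



/-! ### Auxiliary: a finite-level identity `σ P − P = n • Q` read in `E(K̄)` along `emb` -/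

/-- **`g • ι P − ι P = n • ι Q` from `σ P − P = n • Q`** when `g ∈ Γ_K` restricts to `σ` along `emb`
(abstract level field `L`, so that the group law of `W(L)` is read with one `DecidableEq` instance; used
with `L = K[9pℓ]`). [cite: GrossLMS1991, §4 (4.2)] [cite: SilvermanAEC2009, VIII.§1] -/
theorem smul_embPoints_sub_eq_zsmul {L : Type} [Field L] [CharZero L] (W : WeierstrassCurve ℚ)
    (emb : L →+* AlgebraicClosure K)
    (ιL : (W.baseChange L).toAffine.Point →+ geomPoints (W.baseChange K))
    (hιL : ∀ P, ιL P = Affine.Point.map (W' := W) emb.toRatAlgHom P)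
    (g : absoluteGaloisGroup K) (σ : L ≃ₐ[ℚ] L)
    (hcomp : ∀ x : L, (show AlgebraicClosure K ≃ₐ[K] AlgebraicClosure K from g) (emb x) = emb (σ x))
    {P Q : (W.baseChange L).toAffine.Point} {n : ℤ} (h : pointGalHom W L σ P - P = n • Q) :
    g • ιL P - ιL P = n • ιL Q := by
  rw [smul_embPoints_eq_of_comp W emb ιL hιL g (σ : L →+* L) hcomp P, map_toRatAlgHom_eq_pointGalHom,
    ← map_sub, h, map_zsmul]

/-! ### Auxiliary: #17b's inertia package at the level written `9 * p * ℓ` -/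

/-- k-ty1 #17b §3–§4 (`exists_mem_inertia_generator_and_forall_smul_eq_pow_smul`,
`mem_of_mem_inertia_and_mem_of_isArithFrobAt`) restated at HSY's level `9·p·ℓ` (the tree states them at
`ℓ·m`; `ℓ·(9p) = 9pℓ` rewritten on the closed statement): an inertia generator `τ₀ ↦ σ_ℓ` through which
`I_𝔓` acts on the `N`-fixed points, and `I_𝔓, Frob_𝔓 ⊆ N'` (the decomposition group above `λ` fixes
`emb K[9p]`). [cite: GrossLMS1991, §3 (p. 239–240)] [cite: McCallumLMS1991, §4 (p. 304)] -/
theorem inertia_package (hK : IsImaginaryQuadratic K) (ι : K →+* ℂ) {p ℓ : ℕ} (hf : 9 * p ≠ 0)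
    (hℓ : ℓ.Prime) (hℓ9p : ¬ ℓ ∣ 9 * p) {v : HeightOneSpectrum (𝓞 K)} (hv : (ℓ : 𝓞 K) ∈ v.asIdeal)
    (hℓP : (Ideal.span {(ℓ : 𝓞 K)}).IsPrime)
    (emb : ringClassField K ι (9 * p * ℓ) →+* AlgebraicClosure K)
    (hemb : ∀ k : K, emb (algebraMap K (ringClassField K ι (9 * p * ℓ)) k) =
      algebraMap K (AlgebraicClosure K) k)
    {𝔓 : Ideal (absIntegers (𝓞 K) K)} (h𝔓 : 𝔓 ∈ v.primesAbove)
    {σ : ringClassField K ι (9 * p * ℓ) ≃ₐ[ℚ] ringClassField K ι (9 * p * ℓ)}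
    (hσ : Subgroup.zpowers σ = ringClassGalOver ι (9 * p * ℓ) (9 * p))
    (N : Subgroup (absoluteGaloisGroup K))
    (hN : ∀ g : absoluteGaloisGroup K, g ∈ N ↔
      ∀ x : ringClassField K ι (9 * p * ℓ),
        (show AlgebraicClosure K ≃ₐ[K] AlgebraicClosure K from g) (emb x) = emb x)
    (N' : Subgroup (absoluteGaloisGroup K))
    (hN' : ∀ g : absoluteGaloisGroup K, g ∈ N' ↔
      ∀ x ∈ {x : ringClassField K ι (9 * p * ℓ) | (x : ℂ) ∈ ringClassField K ι (9 * p)},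
        (show AlgebraicClosure K ≃ₐ[K] AlgebraicClosure K from g) (emb x) = emb x)
    (X : Type) [MulAction (absoluteGaloisGroup K) X] :
    (∃ τ₀ ∈ 𝔓.inertia (absoluteGaloisGroup K),
      (∀ x : ringClassField K ι (9 * p * ℓ),
        (show AlgebraicClosure K ≃ₐ[K] AlgebraicClosure K from τ₀) (emb x) = emb (σ x)) ∧
      ∀ τ ∈ 𝔓.inertia (absoluteGaloisGroup K), ∃ i : ℕ,
        (τ₀ ^ i)⁻¹ * τ ∈ N ∧ ∀ Q : X, (∀ h ∈ N, h • Q = Q) → τ • Q = (τ₀ ^ i) • Q) ∧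
    (∀ τ ∈ 𝔓.inertia (absoluteGaloisGroup K), τ ∈ N') ∧
    (∀ F : absoluteGaloisGroup K, IsArithFrobAt (𝓞 K) F 𝔓 → F ∈ N') := by
  suffices H : ∀ n : ℕ, ℓ * (9 * p) = n →
      ∀ (emb : ringClassField K ι n →+* AlgebraicClosure K)
        (_ : ∀ k : K, emb (algebraMap K (ringClassField K ι n) k) = algebraMap K (AlgebraicClosure K) k)
        (σ : ringClassField K ι n ≃ₐ[ℚ] ringClassField K ι n)
        (_ : Subgroup.zpowers σ = ringClassGalOver ι n (9 * p))
        (N : Subgroup (absoluteGaloisGroup K))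
        (_ : ∀ g : absoluteGaloisGroup K, g ∈ N ↔
          ∀ x : ringClassField K ι n,
            (show AlgebraicClosure K ≃ₐ[K] AlgebraicClosure K from g) (emb x) = emb x)
        (N' : Subgroup (absoluteGaloisGroup K))
        (_ : ∀ g : absoluteGaloisGroup K, g ∈ N' ↔
          ∀ x : ringClassField K ι n, (x : ℂ) ∈ ringClassField K ι (9 * p) →
            (show AlgebraicClosure K ≃ₐ[K] AlgebraicClosure K from g) (emb x) = emb x),
        (∃ τ₀ ∈ 𝔓.inertia (absoluteGaloisGroup K),
          (∀ x : ringClassField K ι n,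
            (show AlgebraicClosure K ≃ₐ[K] AlgebraicClosure K from τ₀) (emb x) = emb (σ x)) ∧
          ∀ τ ∈ 𝔓.inertia (absoluteGaloisGroup K), ∃ i : ℕ,
            (τ₀ ^ i)⁻¹ * τ ∈ N ∧ ∀ Q : X, (∀ h ∈ N, h • Q = Q) → τ • Q = (τ₀ ^ i) • Q) ∧
        (∀ τ ∈ 𝔓.inertia (absoluteGaloisGroup K), τ ∈ N') ∧
        (∀ F : absoluteGaloisGroup K, IsArithFrobAt (𝓞 K) F 𝔓 → F ∈ N') from
    H _ (by ring) emb hemb σ hσ N hN N' (fun g ↦ (hN' g).trans (by simp only [Set.mem_setOf_eq]))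
  intro n hn emb hemb σ hσ N hN N' hN'
  subst hn
  exact ⟨exists_mem_inertia_generator_and_forall_smul_eq_pow_smul hK ι hℓ hf hℓ9p hv hℓP emb hemb h𝔓 hσ
      N hN (X := X),
    mem_of_mem_inertia_and_mem_of_isArithFrobAt hK ι hℓ hf hℓ9p hv hℓP emb hemb h𝔓 N' hN'⟩

/-! ### Auxiliary: `(σ_ℓ − 1) D_ℓ y_ℓ = (ℓ + 1) y_ℓ` in `W₀(K[9pℓ])` ((3.5) + (ES1) + `a_ℓ(E₉) = 0`) -/

/-- **Gross's (3.5) applied to a point: `σ(D_σ z) − D_σ z = (ℓ + 1) · z` whenever `σ^{ℓ+1} = 1` and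
`Tr_σ z = Σ_{i ≤ ℓ} σ^i z = 0`** — for any curve `W/ℚ`, any field `L` of characteristic `0`, any
`σ ∈ Aut(L/ℚ)` and the derivative operator `D_σ = Σ_{i ≤ ℓ} i σ^i` of the tree (`KolyvaginOperator.derivOp`):
the group-ring identity `(σ − 1) D_σ = (ℓ + 1) − Tr_σ` (`KolyvaginEuler.of_sub_one_mul_derivElt`) read on the
`⟨σ⟩`-module `W(L)` (the group law of `W(L)` read with the ambient `DecidableEq L`).  Used with `z = y_ℓ`
(single prime) and `z = D_{ℓ'} y_{ℓℓ'}` (pair level).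
[cite: GrossLMS1991, §3 (3.5), Prop. 3.6 (proof)] [cite: McCallumLMS1991, §4 (4)] -/
theorem pointGalHom_derivOp_sub_eq_of_trace_eq_zero (W : WeierstrassCurve ℚ) {L : Type} [Field L] [CharZero L]
    [DecidableEq L] {σ : L ≃ₐ[ℚ] L} {ℓ : ℕ} (hσ : σ ^ (ℓ + 1) = 1) {z : (W.baseChange L).toAffine.Point}
    (htr : ∑ i ∈ Finset.range (ℓ + 1), pointGalHom W L (σ ^ i) z = 0) :
    pointGalHom W L σ (KolyvaginOperator.derivOp (pointGalHom W L) σ ℓ z) -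
      KolyvaginOperator.derivOp (pointGalHom W L) σ ℓ z = ((ℓ + 1 : ℕ) : ℤ) • z := by
  -- the cyclic group `⟨σ⟩` acting on `A = W(L)` through `pointGalHom` (as in #R-b)
  letI : CommGroup (Subgroup.zpowers σ) :=
    { (inferInstance : Group (Subgroup.zpowers σ)) with mul_comm := mul_comm' }
  letI act : DistribMulAction (Subgroup.zpowers σ) ((W.baseChange L).toAffine.Point) :=
    DistribMulAction.compHom _ ((pointGalHom W L).comp (Subgroup.zpowers σ).subtype)
  have hsmul : ∀ (h : Subgroup.zpowers σ) (Q : (W.baseChange L).toAffine.Point),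
      h • Q = pointGalHom W L (h : L ≃ₐ[ℚ] L) Q := fun _ _ ↦ rfl
  have hs_pow : ∀ i : ℕ, (((⟨σ, Subgroup.mem_zpowers σ⟩ : Subgroup.zpowers σ) ^ i : Subgroup.zpowers σ) :
      L ≃ₐ[ℚ] L) = σ ^ i := fun i ↦ by
    rw [Subgroup.coe_pow]
  -- `D_σ z` in the group-ring currency
  have hD : KolyvaginEuler.grAct ((W.baseChange L).toAffine.Point)
        (KolyvaginEuler.derivElt (⟨σ, Subgroup.mem_zpowers σ⟩ : Subgroup.zpowers σ) ℓ) z =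
      KolyvaginOperator.derivOp (pointGalHom W L) σ ℓ z := by
    rw [KolyvaginEuler.grAct_derivElt]
    unfold KolyvaginOperator.derivOp
    refine Finset.sum_congr rfl fun i _ ↦ ?_
    rw [hsmul, hs_pow]
  have hσpow : (⟨σ, Subgroup.mem_zpowers σ⟩ : Subgroup.zpowers σ) ^ (ℓ + 1) = 1 := by
    apply Subtype.ext
    rw [Subgroup.coe_pow, Subgroup.coe_one, hσ]
  have htrace : KolyvaginEuler.grAct ((W.baseChange L).toAffine.Point)
      (KolyvaginEuler.traceElt (⟨σ, Subgroup.mem_zpowers σ⟩ : Subgroup.zpowers σ) ℓ) z = 0 := by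
    rw [KolyvaginEuler.grAct_traceElt]
    have : ∀ i ∈ Finset.range (ℓ + 1),
        (⟨σ, Subgroup.mem_zpowers σ⟩ : Subgroup.zpowers σ) ^ i • z = pointGalHom W L (σ ^ i) z := fun i _ ↦ by
      rw [hsmul, hs_pow]
    rw [Finset.sum_congr rfl this, htr]
  -- Gross (3.5): `(σ − 1) D_σ = (ℓ + 1) − Tr_σ`, applied to `z`
  have key := congrArg (fun r ↦ KolyvaginEuler.grAct ((W.baseChange L).toAffine.Point) r z)
    (KolyvaginEuler.of_sub_one_mul_derivElt (ℓ := ℓ) hσpow)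
  rw [KolyvaginEuler.grAct_mul, map_sub, map_sub, LinearMap.sub_apply, LinearMap.sub_apply,
    KolyvaginEuler.grAct_of, KolyvaginEuler.grAct_one, KolyvaginEuler.grAct_natCast, htrace, sub_zero, hD,
    hsmul] at key
  rw [← natCast_zsmul] at key
  exact key

/-- **`σ_ℓ(D_ℓ y_ℓ) − D_ℓ y_ℓ = (ℓ + 1) · y_ℓ`** for HSY's CM point `y_ℓ` of conductor `9pℓ` on the minimal
model `W₀` of `E₉` and a generator `σ_ℓ` of `G_ℓ = Gal(K[9pℓ]/K[9p])`: Gross's (3.5) (the previous lemma) with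
(ES1) `Tr_ℓ y_ℓ = a_ℓ · y₁` (#R-b) and `a_ℓ(E₉) = 0` at `ℓ ≡ 2 (3)` — the ROOT of the FLIP one-call is
`R = l' · y_ℓ`, `2 l' = ℓ + 1`. [cite: GrossLMS1991, §3 (3.3), (3.5), Prop. 3.7 (1)]
[cite: McCallumLMS1991, §4 (4)] [cite: HuShuYin2019, §4.1] -/
theorem pointGalHom_derivOp_sub_eq {ω : K} (hω : ω ^ 2 + ω + 1 = 0) (h2 : Module.finrank ℚ K = 2)
    (ι : K →+* ℂ) [(⟨0, 0, 1, 0, -1⟩ : WeierstrassCurve ℚ).IsElliptic]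
    [(⟨0, 0, 1, 0, -1⟩ : WeierstrassCurve ℚ).IsGloballyMinimal]
    (Dt : ModularParametrizationData (⟨0, 0, 1, 0, -1⟩ : WeierstrassCurve ℚ) 243)
    {p ℓ : ℕ} (hp3 : p % 3 = 1) (hℓ : ℓ.Prime) (hℓ3 : ℓ % 3 = 2) (hℓ2 : ℓ ≠ 2) (hℓp : ¬ ℓ ∣ p)
    {σ : ringClassField K ι (9 * p * ℓ) ≃ₐ[ℚ] ringClassField K ι (9 * p * ℓ)}
    (hσ : Subgroup.zpowers σ = ringClassGalOver ι (9 * p * ℓ) (9 * p))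
    {y y₀ : ((⟨0, 0, 1, 0, -1⟩ : WeierstrassCurve ℚ).baseChange (ringClassField K ι (9 * p * ℓ))).toAffine.Point}
    (hy : Affine.Point.map (W' := (⟨0, 0, 1, 0, -1⟩ : WeierstrassCurve ℚ))
        (ringClassField K ι (9 * p * ℓ)).subtype.toRatAlgHom y =
      Dt.φ (heegnerTau ((ℓ : ℤ) ^ 2 * (81 * ((p : ℤ) ^ 2 + 4 * p + 16)),
        (ℓ : ℤ) * (-(9 * (4 * (p : ℤ) ^ 2 + 17 * p + 72))), 4 * (p : ℤ) ^ 2 + 18 * p + 81)))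
    (hy₀ : Affine.Point.map (W' := (⟨0, 0, 1, 0, -1⟩ : WeierstrassCurve ℚ))
        (ringClassField K ι (9 * p * ℓ)).subtype.toRatAlgHom y₀ =
      Dt.φ (heegnerTau (81 * ((p : ℤ) ^ 2 + 4 * p + 16), -(9 * (4 * (p : ℤ) ^ 2 + 17 * p + 72)),
        4 * (p : ℤ) ^ 2 + 18 * p + 81))) :
    pointGalHom (⟨0, 0, 1, 0, -1⟩ : WeierstrassCurve ℚ) (ringClassField K ι (9 * p * ℓ)) σ
        (KolyvaginOperator.derivOp
          (pointGalHom (⟨0, 0, 1, 0, -1⟩ : WeierstrassCurve ℚ) (ringClassField K ι (9 * p * ℓ))) σ ℓ y) -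
      KolyvaginOperator.derivOp
        (pointGalHom (⟨0, 0, 1, 0, -1⟩ : WeierstrassCurve ℚ) (ringClassField K ι (9 * p * ℓ))) σ ℓ y =
      ((ℓ + 1 : ℕ) : ℤ) • y := by
  have hK := JZero.isImaginaryQuadratic_of_sq_add_self_add_one hω h2
  have hdK := JZero.discr_eq_neg_three_of_sq_add_self_add_one hω h2
  have hinert := JZero.span_natCast_isPrime_of_mod_three_eq_two hω h2 hℓ hℓ3
  have hp0 : p ≠ 0 := by rintro rfl; simp at hp3
  have hℓ3' : ℓ ≠ 3 := by rintro rfl; simp at hℓ3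
  have hℓ9 : ¬ ℓ ∣ 9 := by
    intro h
    have h' : ℓ ∣ 3 ^ 2 := by norm_num; exact h
    exact hℓ3' ((Nat.prime_dvd_prime_iff_eq hℓ Nat.prime_three).mp (hℓ.dvd_of_dvd_pow h'))
  have hℓ9p : ¬ ℓ ∣ 9 * p := by
    intro h
    rcases (Nat.Prime.dvd_mul hℓ).mp h with h9 | hp'
    · exact hℓ9 h9
    · exact hℓp hp'
  have ha0 : (⟨0, 0, 1, 0, -1⟩ : WeierstrassCurve ℚ).LFunction ℓ = 0 :=
    JZero.lFunction_eq_zero_of_j_eq_zero_of_mod_three_eq_two _ j_sylvesterNineMinimal hℓ hℓ3 hℓ2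
      (not_dvd_minimalDiscriminantInt_sylvesterNineMinimal hℓ hℓ3')
  have hordσ : orderOf σ = ℓ + 1 := orderOf_eq_succ_sylvester_prime hK ι hp0 hℓ hℓ9p hinert hσ
  refine pointGalHom_derivOp_sub_eq_of_trace_eq_zero _ (by rw [← hordσ, pow_orderOf_eq_one]) ?_
  rw [sum_range_pointGalHom_pow_eq_lFunction_smul_sylvester_prime hK hdK ι Dt hp3 hℓ hℓ3 hℓp hinert hσ hy hy₀,
    ha0, zero_smul]

end Summit.BirchSwinnertonDyer.BirchSwinnertonDyer.Theorems.SylvesterTwoCMFlip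

end
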